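import Summits.QuantumFields.YangMills.Theorems.BalabanUVNodesN05SubBP2DSlotExistsOfThm33JunctionHAtZdFrame
import Literature.MathematicalPhysics.QuantumFieldTheory.Balaban1983to89.Node00.Record13CarriersB8SubBP2D

/-!
# BalabanUVNodes ∕ N05 AT THE STAGE-13 RECORD ([Balaban1985RegularSpaces] Lemma 1 p. 79 – Thm 8 p. 101; [Balaban1989LargeFieldII] Thm 1 p. 355 for the record):
# N05 HOLDS AT A [B8″P₂D]-PINNED SEPARATED-RANGE RECORD OF EVERY ADMISSIBLE PARAMETER FROM [4]'s LETTERS, N06's THEOREM 3.3 IN ITS OWN NODE SENTENCE (γ) AT THE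
# `ℤᵈ` FRAME OF RECORD, AND SIX JUNCTION BINDERS — the record-level image of `BalabanUVNodesN05SubBP2DSlotExistsOfThm33JunctionHAtZdFrame` (this seat's
# `…N05AtRecord13SubBP2DSepOfThm33JunctionH` pattern, p629708, with `hP6 ∕ hdict ∕ hcurv ∕ havg` GONE and the frame N06's own)

Track A of `YM-PLAN.md` (cell `pub-ymgap`, HUMAN RULING D-0062), node **N05**; seat `pub-ymgap-dag-n05-d` (g14), 2026-08-28; bears on K1⁹ `stmt-QuantumFields-27364`
(`--supports … --as helper`, count-neutral).

WHY.  `exists_residB8_b8LeafOfRecordSubBP₂D_cutSubBP₅_of_letters_thm33_junctionH_zdFrame` concludes `∃ lam c₁ ρ₀, B8LeafOfRecordSubBP₂D θ₃ (lam.cutSubBP₅ c₁ ρ₀)` over a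
`Stage3Params`, behind Proposition 6's thresholds `∃ c35₀ M₆ > 0, ∀ c35 ≥ c35₀, ∀ M₃ ≥ M₆`; at the separated-range Stage-13 record (dag-n05-w1's one-pin «P₂D» record
`Node00.Record13CarriersB8SubBP2D`, p619439) every admissible presenting parameter `θ : Stage13Params F N` then HAS a world whose `b8` leaf holds and at which `Dag.B8_main`
holds at every run — N05 at the record — from: [4] Thm 3.1's letters at the (1.3)–(1.5)-admissible law members, N06's node sentence (γ) `B9.Thm33Printed c35 (geoZd …) (bgZd …)
Gp (GAZdFamOfOps … ops)` at dag-n06-e's `ℤᵈ` frame of record, the six remaining junction binders at the members of `IdxB8SubD θ.toStage3Params` (`InvAtH ∕ LandauAt ∕ HolderAtδ2 ∕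
LinBddAt ∕ SrcAt ∕ SrcHolderAtδ2` — N06's object layer `G(U₀) ∕ R(U₀)` on `Ω₀ = ℤᵈ`), the letter pin `hops` (genuine `Q*aQ` and `Δ′`), the junction's primitive constants,
`5 ≤ L` and a window `0 < γw ≤ θ.γ`.  This is the record-level statement the K1 knit (dag-n24-w1 ∕ n24-c's slot-parametric closers) and the chair read for the N05 row in the
junction currency with the fewest displayed N06 hypotheses to date (booking is theirs).

WHAT IS PROVED (two theorems; `obtain` ×3 + the record module's `Iff.rfl` faces each; no estimate; no new definition):
* ★★ **`exists_isRecordOfRecord₁₃CSepSB8subBP₂D_b8_of_letters_thm33_junctionH_zdFrame`** — `∃ c35₀ M₆ > 0, ∀ c35 ≥ c35₀, ∀ M₃ ≥ M₆, ∀ γw ∈ ]0, θ.γ],` hypotheses of the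
  `…_zdFrame` row over `θ.toStage3Params` ⊢ `∃ lam c₁ ρ₀ w, IsRecordOfRecord₁₃CSepSB8subBP₂D F N (datumOfRecord₁₃Sep F N θ hP) w ∧ w.γ = γw ∧ w.up = upOfRecord₅CSC …
  (θ.pinB8SubBP₂D (lam.cutSubBP₅ c₁ ρ₀)) … ∧ ∀ P, (leavesP w P).b8 ∧ Dag.B8_main (leavesP w P)`.
* ★★ **`exists_isRecordOfRecord₁₃CSepSB8subBP₂D_b8_of_letters_thm33_junctionH_zdFrameI`** (§2) — the same for the INDEX-GENERIC edition `…_zdFrameI` (any `I`, `π : I → MemberZd`,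
  `mem` with `π (mem M j m) = memZd M j m` at the admissible members; the frame of record read through `π`; N06's sentence over `I` only).
HONEST FRAMING: bookkeeping; 0 estimates; [4]'s letters, `Thm33Printed` and the six junction binders are HYPOTHESES (N06 content; `m ≥ 1` OPEN; class-wide satisfiability NOT
claimed — nothing supplies the object binders on `Ω₀ = ℤᵈ` yet, dag-n05-d g13 JUNCTION ROAD NOTE); CLASS NOTE (dag-n05-w2 `B8IdxB8SubDPrintClassGap`: binders over ALL `IdxB8SubD`
members ⊋ print's (1.3)–(1.4) class; exit = one `Subtype` cut) applies verbatim; ∃-currency over the layer AND the world; Proposition 7 inside the slot in the repaired currency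
`c₇OfRecord` (WATCH-P7-CURRENCY-RECORD); the booking of this record ∕ currency as N05's statement of record is the planners' ∕ chair's; count-neutral; **N05 NOT discharged**;
Bałaban AS PRINTED with locators; one finite 𝕋⁴ programme at fixed ε; nothing continuum ∕ ℝ⁴ ∕ OS ∕ mass-gap ∕ Clay.  No `sorry`, no new definition.  Unit `pub-ymgap-dag-n05-d` (g14).
[cite: Balaban1985RegularSpaces, Lemma 1 p.79, Thm 2 p.83, Prop. 3 p.87, Thm 4 p.88, Prop. 5 p.94, Prop. 6 p.99, Prop. 7 p.100, Thm 8 (1.146) p.101, (1.3)–(1.5) p.77; Balaban1985BackgroundPropagators, Thm 3.1 p.397, Thm 3.3 p.399, (3.41) p.397, (3.69) p.404; Balaban1989LargeFieldII, Thm 1 + (0.1) pp.355–356]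
-/

noncomputable section

namespace Summit.QuantumFields.YangMills.BalabanUVNodes.N05AtRecord13SubBP2DSepOfThm33JunctionHAtZdFrame

open Literature.MathematicalPhysics.QuantumFieldTheory.Balaban1983to89
open Literature.MathematicalPhysics.QuantumFieldTheory.Balaban1983to89.Node00
open Literature.MathematicalPhysics.QuantumFieldTheory.Balaban1983to89.T4Continuum
open Literature.MathematicalPhysics.QuantumFieldTheory.Balaban1983to89.DagBinding
open Literature.MathematicalPhysics.QuantumFieldTheory.Balaban1983to89.B8IdxB8LawsB (IdxB8LawsB)
open Literature.MathematicalPhysics.QuantumFieldTheory.Balaban1983to89.B8LeafModelZd (ZdIdx)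
open Literature.MathematicalPhysics.QuantumFieldTheory.Balaban1983to89.B8TowerBondsPrinted (towerBondsP)
open Literature.MathematicalPhysics.QuantumFieldTheory.Balaban1983to89.B8SockLettersRD (SockLettersRD)
open Literature.MathematicalPhysics.QuantumFieldTheory.Balaban1983to89.B8Eq138LandauZd (covLap QT)
open Literature.MathematicalPhysics.QuantumFieldTheory.Balaban1983to89.B9SupplySockB9P3ZdLetters (OpsZd)
open Literature.MathematicalPhysics.QuantumFieldTheory.Balaban1983to89.B9SupplySockB9P3ZdAt (LandauAt SrcAt)
open Literature.MathematicalPhysics.QuantumFieldTheory.Balaban1983to89.B9SupplySockB9P3ZdAtLin (LinBddAt)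
open Literature.MathematicalPhysics.QuantumFieldTheory.Balaban1983to89.B9SupplySockB9P3ZdGammaUnivDelta2 (HolderAtδ2)
open Literature.MathematicalPhysics.QuantumFieldTheory.Balaban1983to89.B9SupplySockB9P3ZdAtHerm (InvAtH)
open Literature.MathematicalPhysics.QuantumFieldTheory.Balaban1983to89.B9SupplySockB9P3ZdGammaUnivDelta2Src (SrcHolderAtδ2)
open Literature.MathematicalPhysics.QuantumFieldTheory.Balaban1983to89.B9SupplySockB9P3ZdFrame (MemberZd memZd bgZd ιCfgZd geoZd ιLocZd)
open Literature.MathematicalPhysics.QuantumFieldTheory.Balaban1983to89.B9SupplySockB9P3ZdLocalLettersOfOps (GAZdFamOfOps)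
open Literature.MathematicalPhysics.QuantumFieldTheory.Balaban1983to89.B9SupplySockB9P3ZdGammaInAkDpZd (withDpZd)
open Literature.MathematicalPhysics.QuantumFieldTheory.Balaban1983to89.B9Eq316AveragingTransposeZdPrinted (withQQP)
open B7Prop1Explicit B7Prop2Explicit B7Prop1Local
open B8Ineq132 (InAk covDerivFwd)
open B7Eq78Linearization (zdBlocking QprimeIter)
open B8Eq119TwistedAxial (bgT)
open B8Eq140Level (SideTouches)
open B8Eq1117Concrete (XSpace)
open B8Prop5ContractionKLevel (Bd2)
open B8LambdaSpaceKLevel (wt)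
open Summit.QuantumFields.YangMills.BalabanUVNodes.N05SubBP2DSlotExistsOfThm33JunctionHAtZdFrame
  (exists_residB8_b8LeafOfRecordSubBP₂D_cutSubBP₅_of_letters_thm33_junctionH_zdFrame
    exists_residB8_b8LeafOfRecordSubBP₂D_cutSubBP₅_of_letters_thm33_junctionH_zdFrameI)

-- `Site` alone could resolve to the torus sites of `Setup.lean`; re-export the `ℤ^d` sites of `B7Prop1Explicit`.
export B7Prop1Explicit (Site)

section AtRecord

variable {F : T4Family} {N : ℕ} [NeZero N]

/-- ★★ **N05 AT A [B8″P₂D]-PINNED SEPARATED-RANGE STAGE-13 RECORD FROM [4]'s LETTERS, N06's NODE SENTENCE (γ) AT THE `ℤᵈ` FRAME OF RECORD AND SIX JUNCTION BINDERS**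
(∃-currency over the residual [B8] layer and the world, behind Proposition 6's thresholds): for `θ : Stage13Params F N` presenting a separated-range datum (`Provisos₁₃Sep`,
`Admissible`, `5 ≤ L`): `∃ c35₀ M₆ > 0` such that for every `c35 ≥ c35₀`, `M₃ ≥ M₆`, any window `0 < γw ≤ θ.γ`, and the hypotheses of
`exists_residB8_b8LeafOfRecordSubBP₂D_cutSubBP₅_of_letters_thm33_junctionH_zdFrame` over `θ.toStage3Params` ([4]'s letters `SLet SLetUB`, any `len ∕ Gp ∕ ops` with the letter pin
`hops`, `B9.Thm33Printed c35 (geoZd …) (bgZd …) Gp (GAZdFamOfOps … ops)`, the six junction binders at the members of `IdxB8SubD`, the primitive constants): there are a residual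
layer `lam`, `c₁ ρ₀`, and a world `w` with `IsRecordOfRecord₁₃CSepSB8subBP₂D F N (datumOfRecord₁₃Sep F N θ hP) w`, `w.γ = γw`, `w.up = upOfRecord₅CSC … (θ.pinB8SubBP₂D (lam.cutSubBP₅ c₁ ρ₀)) …`,
and at every run the `b8` leaf and `Dag.B8_main`.  Proof: the `…_zdFrame` ∃λ theorem (`2 ≤ D` from admissibility) ∘ dag-n05-w1's `exists_world_isRecordOfRecord₁₃CSepSB8subBP₂D` ∘
the `Iff.rfl` face `upOfRecord₅CSC_toStage5₁₃_pinB8SubBP₂D_b8_iff` ∘ `b8_b11_b10_main_iff_of_…`.  Hypotheses are N06 content; N05 NOT discharged.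
[cite: Balaban1985RegularSpaces, Lemma 1 – Thm 8 pp.79–101; Balaban1985BackgroundPropagators, Thm 3.1 p.397, Thm 3.3 p.399, (3.69) p.404; Balaban1989LargeFieldII, Thm 1 + (0.1) pp.355–356 (bookkeeping)] -/
theorem exists_isRecordOfRecord₁₃CSepSB8subBP₂D_b8_of_letters_thm33_junctionH_zdFrame (θ : Stage13Params F N) (hP : θ.Provisos₁₃Sep F N) (hθ : θ.Admissible F N)
    (hL5 : 5 ≤ θ.toStage3Params.L) [FiniteDimensional ℝ θ.toStage3Params.𝔸] :
    ∃ c35₀ M₆ : ℝ, 0 < c35₀ ∧ 0 < M₆ ∧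
      ∀ ⦃c35 : ℝ⦄, c35₀ ≤ c35 → ∀ ⦃M₃ : ℝ⦄, M₆ ≤ M₃ →
      -- a run window inside the presented one
      ∀ {γw : ℝ}, 0 < γw ∧ γw ≤ θ.γ →
      -- [Balaban1985BackgroundPropagators] Thm 3.1's letter bounds and threshold
      ∀ {B₀'H B₂' BG BR cL : ℝ}, 0 < B₀'H → 0 ≤ B₂' → 0 ≤ BG → 0 ≤ BR → 0 < cL →
      -- [4]'s letters AT THE (1.3)–(1.5)-ADMISSIBLE `Ω₀ = ℤᵈ` LAW MEMBERS (p619291's texts verbatim): existence side and uniqueness side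
      (∀ i : ZdIdx θ.toStage3Params.D θ.toStage3Params.L, i.Ω 0 = Set.univ → IdxB8LawsB θ.toStage3Params.L i → B8ConstraintBonds.DomainSeq θ.toStage3Params.L i.Ω → (∀ l, l < i.k → ∀ z ∈ i.Λs i.k l, ((θ.toStage3Params.L : ℤ) ^ l) • z ∈ B8ConstraintBonds.Lam θ.toStage3Params.L i.Ω l) → SockLettersRD (𝔸 := θ.toStage3Params.𝔸) θ.toStage3Params.L BG BR B₀'H B₂' cL i.η i.k i.Ω i.Λs) →
      (∀ i : ZdIdx θ.toStage3Params.D θ.toStage3Params.L, i.Ω 0 = Set.univ → IdxB8LawsB θ.toStage3Params.L i → B8ConstraintBonds.DomainSeq θ.toStage3Params.L i.Ω → (∀ l, l < i.k → ∀ z ∈ i.Λs i.k l, ((θ.toStage3Params.L : ℤ) ^ l) • z ∈ B8ConstraintBonds.Lam θ.toStage3Params.L i.Ω l) → ∀ α₀ : ℝ, 0 < α₀ → α₀ ≤ cL → ∀ U₀ : Site θ.toStage3Params.D → Fin θ.toStage3Params.D → θ.toStage3Params.𝔸ˣ, (∀ x κ, U₀ x κ ∈ unitaryUnits θ.toStage3Params.𝔸)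 →
        InAk θ.toStage3Params.L i.k i.η α₀ i.Ω U₀ →
        ∃ (g Δ : (Site θ.toStage3Params.D → θ.toStage3Params.𝔸) →ₗ[ℂ] (Site θ.toStage3Params.D → θ.toStage3Params.𝔸)) (q : (Site θ.toStage3Params.D → θ.toStage3Params.𝔸) →ₗ[ℂ] (ℕ → Site θ.toStage3Params.D → θ.toStage3Params.𝔸))
          (qs : (ℕ → Site θ.toStage3Params.D → θ.toStage3Params.𝔸) →ₗ[ℂ] (Site θ.toStage3Params.D → θ.toStage3Params.𝔸)) (Aw c : (ℕ → Site θ.toStage3Params.D → θ.toStage3Params.𝔸) →ₗ[ℂ] (ℕ → Site θ.toStage3Params.D → θ.toStage3Params.𝔸))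
          (H' : XSpace θ.toStage3Params.D i.k θ.toStage3Params.𝔸 →ₗ[ℂ] (Site θ.toStage3Params.D → θ.toStage3Params.𝔸)),
          (∀ x : Site θ.toStage3Params.D → θ.toStage3Params.𝔸, (∃ C : ℝ, ∀ y, ‖x y‖ ≤ C) → g (Δ x + qs (Aw (q x))) = x) ∧ (∀ φ, qs (c (q (g (g (qs φ))))) = qs φ) ∧
          (∀ (f : Site θ.toStage3Params.D → θ.toStage3Params.𝔸), ∀ x ∈ i.Ω 0, Δ f x = covLap i.η U₀ ((i.Ω 0).indicator f) x) ∧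
          (∀ (μ : ℕ → Site θ.toStage3Params.D → θ.toStage3Params.𝔸), ∀ x ∈ i.Ω 0, qs μ x = QT θ.toStage3Params.L i.k (i.Λs i.k) U₀ μ x) ∧
          (∀ (f : Site θ.toStage3Params.D → θ.toStage3Params.𝔸) (n : ℕ), n ≤ i.k → ∀ y ∈ i.Λs i.k n, q f n y = QprimeIter (zdBlocking θ.toStage3Params.D θ.toStage3Params.L) (bgT θ.toStage3Params.L U₀) n f y) ∧
          (∀ (f : Site θ.toStage3Params.D → θ.toStage3Params.𝔸) (n : ℕ) (y : Site θ.toStage3Params.D), ¬ (n ≤ i.k ∧ y ∈ i.Λs i.k n) → q f n y = 0) ∧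
          (∀ (X : XSpace θ.toStage3Params.D i.k θ.toStage3Params.𝔸) (x : Site θ.toStage3Params.D), ‖H' X x‖ ≤ B₀'H * ‖X‖) ∧
          (∀ n, n ≤ i.k → ∀ (X : XSpace θ.toStage3Params.D i.k θ.toStage3Params.𝔸), ∀ p ∈ {b : Site θ.toStage3Params.D × Fin θ.toStage3Params.D | SideTouches (i.Ω n) b.1 b.2},
            wt θ.toStage3Params.L i.η n * ‖covDerivFwd i.η U₀ p.2 (H' X) p.1‖ ≤ B₀'H * ‖X‖) ∧
          (∀ X : XSpace θ.toStage3Params.D i.k θ.toStage3Params.𝔸, Bd2 θ.toStage3Params.L i.η i.k i.Ω (covLap i.η U₀ (H' X)) (B₂' * ‖X‖)) ∧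
          (∀ (Y : XSpace θ.toStage3Params.D i.k θ.toStage3Params.𝔸) (n : ℕ) (hn : n ≤ i.k) (y : Site θ.toStage3Params.D), y ∈ i.Λs i.k n →
            QprimeIter (zdBlocking θ.toStage3Params.D θ.toStage3Params.L) (bgT θ.toStage3Params.L U₀) n (H' Y) y = Y (⟨n, Nat.lt_succ_of_le hn⟩, y)) ∧
          (∀ (f : Site θ.toStage3Params.D → θ.toStage3Params.𝔸) (r : ℝ), 0 ≤ r → Bd2 θ.toStage3Params.L i.η i.k i.Ω f r →
            (∀ x, ‖g f x‖ ≤ BG * r) ∧ ∀ n, n ≤ i.k → ∀ p ∈ {b : Site θ.toStage3Params.D × Fin θ.toStage3Params.D | SideTouches (i.Ω n) b.1 b.2},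
              wt θ.toStage3Params.L i.η n * ‖covDerivFwd i.η U₀ p.2 (g f) p.1‖ ≤ BG * r) ∧
          (∀ (f : Site θ.toStage3Params.D → θ.toStage3Params.𝔸) (r : ℝ), 0 ≤ r → Bd2 θ.toStage3Params.L i.η i.k i.Ω f r → Bd2 θ.toStage3Params.L i.η i.k i.Ω (f - g (qs (c (q (g f))))) (BR * r))) →
      -- N06's `ℤᵈ` FRAME OF RECORD (dag-n06-e): lengths `len`, geometries `geoZd`, backgrounds `bgZd`, the kernel family `GAZdFamOfOps … ops` READ OFF the letters `ops`
      -- (dag-n06-e's `B9SupplySockB9P3ZdLocalLettersOfOps`), locality map `ιLocZd`; the (3.8)-side family `Gp` of Theorems 3.1–3.2 stays free (read by `Thm33Printed` only)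
      ∀ (len : Site θ.toStage3Params.D → ℝ) (Gp : ∀ x, B9.KernelFamily (geoZd θ.toStage3Params.𝔸 θ.toStage3Params.L len x) (bgZd θ.toStage3Params.𝔸 θ.toStage3Params.L x))
        (ops : ℝ → ZdIdx θ.toStage3Params.D θ.toStage3Params.L → ℕ → OpsZd θ.toStage3Params.D θ.toStage3Params.𝔸)
      -- THE GENUINE AVERAGING LETTER `Q*aQ` (EDITION P, dag-n06-b) AND THE GENUINE CURVATURE LETTER `Δ′(U₀)` (dag-n06-w2's `withDpZd`), pinned pointwise
        (τ : θ.toStage3Params.𝔸 →ₗ[ℂ] ℂ) {Cτ : ℝ}, (∀ x y : θ.toStage3Params.𝔸, |(τ (star x * y)).re| ≤ Cτ * ‖x‖ * ‖y‖) →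
      ∀ (ops₀ : ℝ → ZdIdx θ.toStage3Params.D θ.toStage3Params.L → ℕ → OpsZd θ.toStage3Params.D θ.toStage3Params.𝔸),
        (∀ (M : ℝ) (i : ZdIdx θ.toStage3Params.D θ.toStage3Params.L) (m : ℕ), ops M i m = withQQP τ θ.toStage3Params.L (fun m' l => towerBondsP θ.toStage3Params.L i.Ω (i.Λs m') l) (withDpZd ops₀) M i m) →
      ∀ {a₃ β cS cSβ : ℝ} {CH : ℝ → ℝ},
      -- N06's THEOREM 3.3 AS PRINTED — ITS NODE SENTENCE (γ) AT THE `ℤᵈ` FRAME OF RECORD, VERBATIM (the kernel family of `G(U₀)` read off `ops`)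
        B9.Thm33Printed c35 (geoZd θ.toStage3Params.𝔸 θ.toStage3Params.L len) (bgZd θ.toStage3Params.𝔸 θ.toStage3Params.L) Gp (GAZdFamOfOps θ.toStage3Params.𝔸 θ.toStage3Params.L len ops) →
      -- dag-n06-b's JUNCTION BINDERS at the (1.3)–(1.5)-admissible members, guarded — SIX of them: NO `havg` (dag-n05-d g13 C), NO `hP6` (dag-n05-e), NO `hdict`, NO `hcurv` (this file)
        (∀ (M : ℝ) (j : IdxB8SubD θ.toStage3Params) (m : ℕ), 1 ≤ M → M₃ ≤ M → m ≤ j.1.1.1.1.k → InvAtH (bgZd θ.toStage3Params.𝔸 θ.toStage3Params.L) θ.toStage3Params.L memZd (ιCfgZd θ.toStage3Params.𝔸 θ.toStage3Params.L) ops c35 a₃ M j.1.1.1.1 m) →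
        (∀ (M : ℝ) (j : IdxB8SubD θ.toStage3Params) (m : ℕ), 1 ≤ M → M₃ ≤ M → m ≤ j.1.1.1.1.k → LandauAt (bgZd θ.toStage3Params.𝔸 θ.toStage3Params.L) θ.toStage3Params.L memZd (ιCfgZd θ.toStage3Params.𝔸 θ.toStage3Params.L) ops c35 a₃ M j.1.1.1.1 m) →
        (∀ (M : ℝ) (j : IdxB8SubD θ.toStage3Params) (m : ℕ), 1 ≤ M → M₃ ≤ M → m ≤ j.1.1.1.1.k → HolderAtδ2 (geoZd θ.toStage3Params.𝔸 θ.toStage3Params.L len) (bgZd θ.toStage3Params.𝔸 θ.toStage3Params.L) (GAZdFamOfOps θ.toStage3Params.𝔸 θ.toStage3Params.L len ops) θ.toStage3Params.L memZd (ιCfgZd θ.toStage3Params.𝔸 θ.toStage3Params.L) ops β len CH M j.1.1.1.1 m) →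
        (∀ (M : ℝ) (j : IdxB8SubD θ.toStage3Params) (m : ℕ), 1 ≤ M → M₃ ≤ M → m ≤ j.1.1.1.1.k → LinBddAt θ.toStage3Params.L ops M j.1.1.1.1 m) →
        (∀ (M : ℝ) (j : IdxB8SubD θ.toStage3Params) (m : ℕ), 1 ≤ M → M₃ ≤ M → m ≤ j.1.1.1.1.k → SrcAt (bgZd θ.toStage3Params.𝔸 θ.toStage3Params.L) θ.toStage3Params.L memZd (ιCfgZd θ.toStage3Params.𝔸 θ.toStage3Params.L) ops c35 a₃ cS M j.1.1.1.1 m) →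
        (∀ (M : ℝ) (j : IdxB8SubD θ.toStage3Params) (m : ℕ), 1 ≤ M → M₃ ≤ M → m ≤ j.1.1.1.1.k → SrcHolderAtδ2 (bgZd θ.toStage3Params.𝔸 θ.toStage3Params.L) θ.toStage3Params.L memZd (ιCfgZd θ.toStage3Params.𝔸 θ.toStage3Params.L) ops c35 a₃ β len cSβ M j.1.1.1.1 m) →
      -- the junction's primitive constants ((3.27) `a₃`, source `c_S c_Sβ`; (3.69)'s `c69` is now `14(D−1)`, dag-n06-w2) and Theorem 8's source size factor `γ₈`
        0 < a₃ → 0 ≤ cS → 0 ≤ cSβ → ∀ {γ₈ : ℝ}, 1 ≤ γ₈ →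
        ∃ (lam : ResidB8 θ.toStage3Params) (c₁ : ℝ) (ρ₀ : ℕ) (w : WorldP), IsRecordOfRecord₁₃CSepSB8subBP₂D F N (datumOfRecord₁₃Sep F N θ hP) w ∧ w.γ = γw ∧
          (∀ P : B12.RunParams, w.up P = upOfRecord₅CSC F N ((θ.pinB8SubBP₂D F N (lam.cutSubBP₅ c₁ ρ₀)).toStage5₁₃ F N) (c₇OfRecord θ.toStage3Params) P) ∧
          ∀ P : B12.RunParams, (leavesP w P).b8 ∧ Dag.B8_main (leavesP w P) := by
  -- the «P₂D» slot row at N06's `ℤᵈ` frame of record, behind Proposition 6's thresholds (`2 ≤ D` from admissibility, chain 13 → 9 → 8 → … → 1)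
  obtain ⟨c35₀, M₆, hc35₀, hM₆, H⟩ :=
    exists_residB8_b8LeafOfRecordSubBP₂D_cutSubBP₅_of_letters_thm33_junctionH_zdFrame θ.toStage3Params (hθ.toStage9.toStage8).1.1.1.1 hL5
  refine ⟨c35₀, M₆, hc35₀, hM₆, ?_⟩
  intro c35 hc35 M₃ hM₃ γw hγw B₀'H B₂' BG BR cL hB₀'H hB₂' hBG hBR hcL SLet SLetUB len Gp ops τ Cτ hCτ ops₀ hops a₃ β cS cSβ CH
    h33 hinv hlan hhol hlin hsrc hsrcH ha₃ hcS hcSβ γ₈ hγ₈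
  -- SOME residual layer inhabits the slot at the P₅-pinned cut
  obtain ⟨lam, c₁, ρ₀, hslot⟩ := H hc35 hM₃ hB₀'H hB₂' hBG hBR hcL SLet SLetUB len Gp ops τ hCτ ops₀ hops h33 hinv hlan hhol hlin hsrc hsrcH
    ha₃ hcS hcSβ hγ₈
  -- the record presented by `θ` at that layer (dag-n05-w1's `Record13CarriersB8SubBP2D`), window `γw`
  obtain ⟨w, hw, hγ, hup⟩ := exists_world_isRecordOfRecord₁₃CSepSB8subBP₂D F N θ hP hθ (lam.cutSubBP₅ c₁ ρ₀) hγw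
  refine ⟨lam, c₁, ρ₀, w, hw, hγ, hup, fun P => ?_⟩
  -- its `b8` leaf IS the slot (`Iff.rfl` face), and N05 follows at every run (in-edges are theorems at the record)
  have hb8 : (leavesP w P).b8 := by
    show (w.up P).b8
    rw [hup P]
    exact (upOfRecord₅CSC_toStage5₁₃_pinB8SubBP₂D_b8_iff F N θ (lam.cutSubBP₅ c₁ ρ₀) P).2 hslot
  exact ⟨hb8, (b8_b11_b10_main_iff_of_isRecordOfRecord₁₃CSepSB8subBP₂D hw P).1.2 fun _ => hb8⟩


/-! ## §2. The index-generic edition -/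

/-- ★★ **THE INDEX-GENERIC EDITION (§2)** — the record-level image of `…_zdFrameI` (§2 of `…SlotExistsOfThm33JunctionHAtZdFrame` v1.1): any index `I`, re-indexing map
`π : I → MemberZd`, member map `mem` with `π (mem M j m) = memZd M j m` at the admissible members, the frame of record read through `π`, N06's sentence over `I` only
(sound sub-indices are the consumer's choice); same six binders, same conclusion at the separated-range Stage-13 record.  Proof: as §1 with `…_zdFrameI`.
Hypotheses are N06 content; N05 NOT discharged. [cite: Balaban1985RegularSpaces, Lemma 1 – Thm 8 pp.79–101; Balaban1985BackgroundPropagators, Thm 3.1 p.397, Thm 3.3 p.399, (3.69) p.404; Balaban1989LargeFieldII, Thm 1 + (0.1) pp.355–356 (bookkeeping)] -/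
theorem exists_isRecordOfRecord₁₃CSepSB8subBP₂D_b8_of_letters_thm33_junctionH_zdFrameI (θ : Stage13Params F N) (hP : θ.Provisos₁₃Sep F N) (hθ : θ.Admissible F N)
    (hL5 : 5 ≤ θ.toStage3Params.L) [FiniteDimensional ℝ θ.toStage3Params.𝔸] :
    ∃ c35₀ M₆ : ℝ, 0 < c35₀ ∧ 0 < M₆ ∧
      ∀ ⦃c35 : ℝ⦄, c35₀ ≤ c35 → ∀ ⦃M₃ : ℝ⦄, M₆ ≤ M₃ →
      -- a run window inside the presented one
      ∀ {γw : ℝ}, 0 < γw ∧ γw ≤ θ.γ →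
      -- [Balaban1985BackgroundPropagators] Thm 3.1's letter bounds and threshold
      ∀ {B₀'H B₂' BG BR cL : ℝ}, 0 < B₀'H → 0 ≤ B₂' → 0 ≤ BG → 0 ≤ BR → 0 < cL →
      -- [4]'s letters AT THE (1.3)–(1.5)-ADMISSIBLE `Ω₀ = ℤᵈ` LAW MEMBERS (p619291's texts verbatim): existence side and uniqueness side
      (∀ i : ZdIdx θ.toStage3Params.D θ.toStage3Params.L, i.Ω 0 = Set.univ → IdxB8LawsB θ.toStage3Params.L i → B8ConstraintBonds.DomainSeq θ.toStage3Params.L i.Ω → (∀ l, l < i.k → ∀ z ∈ i.Λs i.k l, ((θ.toStage3Params.L : ℤ) ^ l) • z ∈ B8ConstraintBonds.Lam θ.toStage3Params.L i.Ω l) → SockLettersRD (𝔸 := θ.toStage3Params.𝔸) θ.toStage3Params.L BG BR B₀'H B₂' cL i.η i.k i.Ω i.Λs) →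
      (∀ i : ZdIdx θ.toStage3Params.D θ.toStage3Params.L, i.Ω 0 = Set.univ → IdxB8LawsB θ.toStage3Params.L i → B8ConstraintBonds.DomainSeq θ.toStage3Params.L i.Ω → (∀ l, l < i.k → ∀ z ∈ i.Λs i.k l, ((θ.toStage3Params.L : ℤ) ^ l) • z ∈ B8ConstraintBonds.Lam θ.toStage3Params.L i.Ω l) → ∀ α₀ : ℝ, 0 < α₀ → α₀ ≤ cL → ∀ U₀ : Site θ.toStage3Params.D → Fin θ.toStage3Params.D → θ.toStage3Params.𝔸ˣ, (∀ x κ, U₀ x κ ∈ unitaryUnits θ.toStage3Params.𝔸) →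
        InAk θ.toStage3Params.L i.k i.η α₀ i.Ω U₀ →
        ∃ (g Δ : (Site θ.toStage3Params.D → θ.toStage3Params.𝔸) →ₗ[ℂ] (Site θ.toStage3Params.D → θ.toStage3Params.𝔸)) (q : (Site θ.toStage3Params.D → θ.toStage3Params.𝔸) →ₗ[ℂ] (ℕ → Site θ.toStage3Params.D → θ.toStage3Params.𝔸))
          (qs : (ℕ → Site θ.toStage3Params.D → θ.toStage3Params.𝔸) →ₗ[ℂ] (Site θ.toStage3Params.D → θ.toStage3Params.𝔸)) (Aw c : (ℕ → Site θ.toStage3Params.D → θ.toStage3Params.𝔸) →ₗ[ℂ] (ℕ → Site θ.toStage3Params.D → θ.toStage3Params.𝔸))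
          (H' : XSpace θ.toStage3Params.D i.k θ.toStage3Params.𝔸 →ₗ[ℂ] (Site θ.toStage3Params.D → θ.toStage3Params.𝔸)),
          (∀ x : Site θ.toStage3Params.D → θ.toStage3Params.𝔸, (∃ C : ℝ, ∀ y, ‖x y‖ ≤ C) → g (Δ x + qs (Aw (q x))) = x) ∧ (∀ φ, qs (c (q (g (g (qs φ))))) = qs φ) ∧
          (∀ (f : Site θ.toStage3Params.D → θ.toStage3Params.𝔸), ∀ x ∈ i.Ω 0, Δ f x = covLap i.η U₀ ((i.Ω 0).indicator f) x) ∧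
          (∀ (μ : ℕ → Site θ.toStage3Params.D → θ.toStage3Params.𝔸), ∀ x ∈ i.Ω 0, qs μ x = QT θ.toStage3Params.L i.k (i.Λs i.k) U₀ μ x) ∧
          (∀ (f : Site θ.toStage3Params.D → θ.toStage3Params.𝔸) (n : ℕ), n ≤ i.k → ∀ y ∈ i.Λs i.k n, q f n y = QprimeIter (zdBlocking θ.toStage3Params.D θ.toStage3Params.L) (bgT θ.toStage3Params.L U₀) n f y) ∧
          (∀ (f : Site θ.toStage3Params.D → θ.toStage3Params.𝔸) (n : ℕ) (y : Site θ.toStage3Params.D), ¬ (n ≤ i.k ∧ y ∈ i.Λs i.k n) → q f n y = 0) ∧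
          (∀ (X : XSpace θ.toStage3Params.D i.k θ.toStage3Params.𝔸) (x : Site θ.toStage3Params.D), ‖H' X x‖ ≤ B₀'H * ‖X‖) ∧
          (∀ n, n ≤ i.k → ∀ (X : XSpace θ.toStage3Params.D i.k θ.toStage3Params.𝔸), ∀ p ∈ {b : Site θ.toStage3Params.D × Fin θ.toStage3Params.D | SideTouches (i.Ω n) b.1 b.2},
            wt θ.toStage3Params.L i.η n * ‖covDerivFwd i.η U₀ p.2 (H' X) p.1‖ ≤ B₀'H * ‖X‖) ∧
          (∀ X : XSpace θ.toStage3Params.D i.k θ.toStage3Params.𝔸, Bd2 θ.toStage3Params.L i.η i.k i.Ω (covLap i.η U₀ (H' X)) (B₂' * ‖X‖)) ∧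
          (∀ (Y : XSpace θ.toStage3Params.D i.k θ.toStage3Params.𝔸) (n : ℕ) (hn : n ≤ i.k) (y : Site θ.toStage3Params.D), y ∈ i.Λs i.k n →
            QprimeIter (zdBlocking θ.toStage3Params.D θ.toStage3Params.L) (bgT θ.toStage3Params.L U₀) n (H' Y) y = Y (⟨n, Nat.lt_succ_of_le hn⟩, y)) ∧
          (∀ (f : Site θ.toStage3Params.D → θ.toStage3Params.𝔸) (r : ℝ), 0 ≤ r → Bd2 θ.toStage3Params.L i.η i.k i.Ω f r →
            (∀ x, ‖g f x‖ ≤ BG * r) ∧ ∀ n, n ≤ i.k → ∀ p ∈ {b : Site θ.toStage3Params.D × Fin θ.toStage3Params.D | SideTouches (i.Ω n) b.1 b.2},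
              wt θ.toStage3Params.L i.η n * ‖covDerivFwd i.η U₀ p.2 (g f) p.1‖ ≤ BG * r) ∧
          (∀ (f : Site θ.toStage3Params.D → θ.toStage3Params.𝔸) (r : ℝ), 0 ≤ r → Bd2 θ.toStage3Params.L i.η i.k i.Ω f r → Bd2 θ.toStage3Params.L i.η i.k i.Ω (f - g (qs (c (q (g f))))) (BR * r))) →
      -- ANY INDEX `I` re-indexed into the `ℤᵈ` members of record by `π`, a member map landing on `memZd` at the admissible members, and N06's `ℤᵈ` FRAME OF RECORD READ
      -- THROUGH `π` (dag-n06-e): lengths `len`, `geoZd ∘ π`, `bgZd ∘ π`, the kernel family `GAZdFamOfOps … ops ∘ π` READ OFF the letters `ops`; `Gp` stays free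
      ∀ {I : Type} (π : I → MemberZd θ.toStage3Params.D θ.toStage3Params.L) (len : Site θ.toStage3Params.D → ℝ) (Gp : ∀ i, B9.KernelFamily (geoZd θ.toStage3Params.𝔸 θ.toStage3Params.L len (π i)) (bgZd θ.toStage3Params.𝔸 θ.toStage3Params.L (π i)))
        (mem : ℝ → ZdIdx θ.toStage3Params.D θ.toStage3Params.L → ℕ → I),
        (∀ (M : ℝ) (j : IdxB8SubD θ.toStage3Params) (m : ℕ), π (mem M j.1.1.1.1 m) = memZd M j.1.1.1.1 m) →
      ∀ (ops : ℝ → ZdIdx θ.toStage3Params.D θ.toStage3Params.L → ℕ → OpsZd θ.toStage3Params.D θ.toStage3Params.𝔸)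
      -- THE GENUINE AVERAGING LETTER `Q*aQ` (EDITION P, dag-n06-b) AND THE GENUINE CURVATURE LETTER `Δ′(U₀)` (dag-n06-w2's `withDpZd`), pinned pointwise
        (τ : θ.toStage3Params.𝔸 →ₗ[ℂ] ℂ) {Cτ : ℝ}, (∀ x y : θ.toStage3Params.𝔸, |(τ (star x * y)).re| ≤ Cτ * ‖x‖ * ‖y‖) →
      ∀ (ops₀ : ℝ → ZdIdx θ.toStage3Params.D θ.toStage3Params.L → ℕ → OpsZd θ.toStage3Params.D θ.toStage3Params.𝔸),
        (∀ (M : ℝ) (i : ZdIdx θ.toStage3Params.D θ.toStage3Params.L) (m : ℕ), ops M i m = withQQP τ θ.toStage3Params.L (fun m' l => towerBondsP θ.toStage3Params.L i.Ω (i.Λs m') l) (withDpZd ops₀) M i m) →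
      ∀ {a₃ β cS cSβ : ℝ} {CH : ℝ → ℝ},
      -- N06's THEOREM 3.3 AS PRINTED — ITS NODE SENTENCE (γ) AT THE `ℤᵈ` FRAME OF RECORD READ THROUGH `π` (over `I`: sound sub-indices are the consumer's choice)
        B9.Thm33Printed c35 (fun i => geoZd θ.toStage3Params.𝔸 θ.toStage3Params.L len (π i)) (fun i => bgZd θ.toStage3Params.𝔸 θ.toStage3Params.L (π i)) Gp (fun i => GAZdFamOfOps θ.toStage3Params.𝔸 θ.toStage3Params.L len ops (π i)) →
      -- dag-n06-b's JUNCTION BINDERS at the (1.3)–(1.5)-admissible members, guarded — SIX of them: NO `havg` (dag-n05-d g13 C), NO `hP6` (dag-n05-e), NO `hdict`, NO `hcurv` (this file)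
        (∀ (M : ℝ) (j : IdxB8SubD θ.toStage3Params) (m : ℕ), 1 ≤ M → M₃ ≤ M → m ≤ j.1.1.1.1.k → InvAtH (fun i => bgZd θ.toStage3Params.𝔸 θ.toStage3Params.L (π i)) θ.toStage3Params.L mem (fun M i m U₀ hU₀ => ιCfgZd θ.toStage3Params.𝔸 θ.toStage3Params.L M i m U₀ hU₀) ops c35 a₃ M j.1.1.1.1 m) →
        (∀ (M : ℝ) (j : IdxB8SubD θ.toStage3Params) (m : ℕ), 1 ≤ M → M₃ ≤ M → m ≤ j.1.1.1.1.k → LandauAt (fun i => bgZd θ.toStage3Params.𝔸 θ.toStage3Params.L (π i)) θ.toStage3Params.L mem (fun M i m U₀ hU₀ => ιCfgZd θ.toStage3Params.𝔸 θ.toStage3Params.L M i m U₀ hU₀) ops c35 a₃ M j.1.1.1.1 m) →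
        (∀ (M : ℝ) (j : IdxB8SubD θ.toStage3Params) (m : ℕ), 1 ≤ M → M₃ ≤ M → m ≤ j.1.1.1.1.k → HolderAtδ2 (fun i => geoZd θ.toStage3Params.𝔸 θ.toStage3Params.L len (π i)) (fun i => bgZd θ.toStage3Params.𝔸 θ.toStage3Params.L (π i)) (fun i => GAZdFamOfOps θ.toStage3Params.𝔸 θ.toStage3Params.L len ops (π i)) θ.toStage3Params.L mem (fun M i m U₀ hU₀ => ιCfgZd θ.toStage3Params.𝔸 θ.toStage3Params.L M i m U₀ hU₀) ops β len CH M j.1.1.1.1 m) →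
        (∀ (M : ℝ) (j : IdxB8SubD θ.toStage3Params) (m : ℕ), 1 ≤ M → M₃ ≤ M → m ≤ j.1.1.1.1.k → LinBddAt θ.toStage3Params.L ops M j.1.1.1.1 m) →
        (∀ (M : ℝ) (j : IdxB8SubD θ.toStage3Params) (m : ℕ), 1 ≤ M → M₃ ≤ M → m ≤ j.1.1.1.1.k → SrcAt (fun i => bgZd θ.toStage3Params.𝔸 θ.toStage3Params.L (π i)) θ.toStage3Params.L mem (fun M i m U₀ hU₀ => ιCfgZd θ.toStage3Params.𝔸 θ.toStage3Params.L M i m U₀ hU₀) ops c35 a₃ cS M j.1.1.1.1 m) →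
        (∀ (M : ℝ) (j : IdxB8SubD θ.toStage3Params) (m : ℕ), 1 ≤ M → M₃ ≤ M → m ≤ j.1.1.1.1.k → SrcHolderAtδ2 (fun i => bgZd θ.toStage3Params.𝔸 θ.toStage3Params.L (π i)) θ.toStage3Params.L mem (fun M i m U₀ hU₀ => ιCfgZd θ.toStage3Params.𝔸 θ.toStage3Params.L M i m U₀ hU₀) ops c35 a₃ β len cSβ M j.1.1.1.1 m) →
      -- the junction's primitive constants ((3.27) `a₃`, source `c_S c_Sβ`; (3.69)'s `c69` is now `14(D−1)`, dag-n06-w2) and Theorem 8's source size factor `γ₈`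
        0 < a₃ → 0 ≤ cS → 0 ≤ cSβ → ∀ {γ₈ : ℝ}, 1 ≤ γ₈ →
        ∃ (lam : ResidB8 θ.toStage3Params) (c₁ : ℝ) (ρ₀ : ℕ) (w : WorldP), IsRecordOfRecord₁₃CSepSB8subBP₂D F N (datumOfRecord₁₃Sep F N θ hP) w ∧ w.γ = γw ∧
          (∀ P : B12.RunParams, w.up P = upOfRecord₅CSC F N ((θ.pinB8SubBP₂D F N (lam.cutSubBP₅ c₁ ρ₀)).toStage5₁₃ F N) (c₇OfRecord θ.toStage3Params) P) ∧
          ∀ P : B12.RunParams, (leavesP w P).b8 ∧ Dag.B8_main (leavesP w P) := by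
  -- the «P₂D» slot row at N06's `ℤᵈ` frame of record read through `π`, behind Proposition 6's thresholds (`2 ≤ D` from admissibility, chain 13 → 9 → 8 → … → 1)
  obtain ⟨c35₀, M₆, hc35₀, hM₆, H⟩ :=
    exists_residB8_b8LeafOfRecordSubBP₂D_cutSubBP₅_of_letters_thm33_junctionH_zdFrameI θ.toStage3Params (hθ.toStage9.toStage8).1.1.1.1 hL5
  refine ⟨c35₀, M₆, hc35₀, hM₆, ?_⟩
  intro c35 hc35 M₃ hM₃ γw hγw B₀'H B₂' BG BR cL hB₀'H hB₂' hBG hBR hcL SLet SLetUB I π len Gp mem hmem ops τ Cτ hCτ ops₀ hops a₃ β cS cSβ CH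
    h33 hinv hlan hhol hlin hsrc hsrcH ha₃ hcS hcSβ γ₈ hγ₈
  -- SOME residual layer inhabits the slot at the P₅-pinned cut
  obtain ⟨lam, c₁, ρ₀, hslot⟩ := H hc35 hM₃ hB₀'H hB₂' hBG hBR hcL SLet SLetUB π len Gp mem hmem ops τ hCτ ops₀ hops h33 hinv hlan hhol hlin hsrc hsrcH
    ha₃ hcS hcSβ hγ₈
  -- the record presented by `θ` at that layer (dag-n05-w1's `Record13CarriersB8SubBP2D`), window `γw`
  obtain ⟨w, hw, hγ, hup⟩ := exists_world_isRecordOfRecord₁₃CSepSB8subBP₂D F N θ hP hθ (lam.cutSubBP₅ c₁ ρ₀) hγw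
  refine ⟨lam, c₁, ρ₀, w, hw, hγ, hup, fun P => ?_⟩
  -- its `b8` leaf IS the slot (`Iff.rfl` face), and N05 follows at every run (in-edges are theorems at the record)
  have hb8 : (leavesP w P).b8 := by
    show (w.up P).b8
    rw [hup P]
    exact (upOfRecord₅CSC_toStage5₁₃_pinB8SubBP₂D_b8_iff F N θ (lam.cutSubBP₅ c₁ ρ₀) P).2 hslot
  exact ⟨hb8, (b8_b11_b10_main_iff_of_isRecordOfRecord₁₃CSepSB8subBP₂D hw P).1.2 fun _ => hb8⟩


end AtRecord

end Summit.QuantumFields.YangMills.BalabanUVNodes.N05AtRecord13SubBP2DSepOfThm33JunctionHAtZdFrame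

end
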